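import Summits.BirchSwinnertonDyer.Rank1Residual.X1.ClassClosureN1
import Literature.NumberTheory.EllipticCurves.CriticalSlopePAdicLFunction
import Literature.NumberTheory.EllipticCurves.PAdicHeights
import HarnessLib
import HarnessLib.Audit.Tags

/-!
# Route `SlopeDichotomyA2` (rung I1-weaken, corner A2): the β-EXIT in `L`-function currency —
# the two heights-free crux statements over the landed critical-slope `p`-adic `L`-function

Definitions file of route `SlopeDichotomyA2` (cell `bsd-schneider-ideate`, seat `bsd-schneider-i1-c2`
holding the route's tenure, gen 11). CLOSED `Prop`s ONLY, NOTHING ASSERTED; no instance, no notation.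
The definition chain D5′ (`OverconvergentModularSymbolsWeightTwo`, p504179/p506248) and D1
(`CriticalSlopePAdicLFunction`, p506498) landed 2026-08-27, so the β-road of the route can now be
STATED without the height `h_β` (definition items D2/D3, blocked: no `D_cris`, no crystalline
Frobenius on `H¹_dR(E/ℚ_p)` in the tree): every β-statement the route needs passes through ONE
predicate, "the critical-slope `L`-function of the pair has a SIMPLE zero at the trivial character",
exactly as the kernel's α-road passes through the Schneider rider
(`ord_T L_p(f,α,T) = 1 ⟺ h_α(P,P) ≠ 0`, barrier file `PAdicHeightBarrierNarrow` conjunct (1)).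

* `HasBetaOrderOne W p` — the β-RIDER of the pair: a newform `f` of `W`, the critical-slope root
  `β` (`β² − a_p β + p = 0`, `v_p(β) = 1`), an overconvergent Hecke eigen-lift `Φ_β` of the
  `p`-stabilised symbol `φ_β` (`OMSWeightTwo.IsEigenLift`, Pollack–Stevens Def. 6.4) and
  `ord_{T=0} L_p(Φ_β, β; T) = 1` (`OMSWeightTwo.criticalSlopePAdicLFunction`, PS §9.1).  Stated as
  an `∃` over the data so that it is never vacuously true; on corner A2 the data short of the order
  clause EXIST by modularity + Hensel + the Pollack–Stevens eigen-lift fact at a non-locally-split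
  pair (proved in the companion proof file `…DegenerateLocusA2BetaExit.lean`), and the constant term
  vanishes there (`r_an = 1`), so the rider reads "`[T¹] L_p(f_β,T) ≠ 0`".
* `BetaOrderOneOnDegenerateA2` (crux S_β2) — on the α-DEGENERATE pairs of corner A2 (a canonical
  cyclotomic height datum violating Schneider) the β-rider holds.  Content: `L_p(f_β,0) = 0`
  (interpolation, PS Prop. 6.5) and `L′_{p,β}(f,1) = (1 − 1/β)² c(f) h_β(P_f,P_f)`
  (Büyükboduk–Pollack–Sasaki arXiv:1811.08216 Cor. 1.1.2 — NO residual-irreducibility hypothesis in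
  its statement; PREPRINT, resting on Kobayashi's non-ordinary Gross–Zagier in progress) with
  `h_β(P,P) = h_α(P,P) − c·log_ω(P)² = −c·log_ω(P)² ≠ 0` on the degenerate locus (Perrin-Riou 1993
  §3.3.7 Rem. (ii), published; kit j244598) and `c(f) ≠ 0` (Gross–Zagier, `r_an = 1`).
* `BSDpOfBetaOrderOneA2` (crux S_β3) — the β-TWIN of the kernel theorem
  `X1.bsdp_of_typeBRankOne_of_schneider`: on corner A2, the β-rider gives `BSD(E,p)`.  Content:
  Perrin-Riou 1993 Prop. 3.4.6 in direction `N = D_β` (published: the ORDINARY main conjecture —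
  Greenberg–Vatsal 2000 Thm. 1.3 for the good lattice, published — feeds her module formula in EVERY
  direction `N` via Prop. 3.4.4; the explicit reciprocity law `Réc(V)` is Colmez 1998), the
  identification of Perrin-Riou's β-coordinate `𝔏_PR^{(β)}` with the Pollack–Stevens `L_p(f_β,T)`
  (BPS Thm. 6.1.2(β) "announced by Hansen" = Hansen arXiv:1508.03982 Thm. 1.2.1, PREPRINT;
  Benois–Büyükboduk, Ann. Math. Québec 2022 Thm. 7.3(iii), published, only up to a scalar in `E^×`
  and for `p ≥ 5`), BPS Cor. 1.1.2 again, Gross–Zagier 1986 and Mazur 1978 (Manin constant).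
  No β-main conjecture is involved.

The composition `BetaOrderOneOnDegenerateA2 → BSDpOfBetaOrderOneA2 → Theses.SlopeDichotomyA2.DegenerateLocusA2`
is two lines (companion proof file).  Source memo: `run/shared/lean/pub/bsd-schneider-ideate/memos/i1-c2/TENURE-SlopeDichotomyA2-g11.md` §§2–3.

References: [PollackStevens2011] Def. 6.4, Prop. 6.5, §9.1; [BuyukbodukPollackSasaki2018]
= arXiv:1811.08216 Thm. 1.1.1, Cor. 1.1.2, Thm. 6.1.2, §6.2; [PerrinRiou1993AIF] =
doi:10.5802/aif.1362 §3.3.7 Rem. (ii), Prop. 3.4.4, Prop. 3.4.6; [Hansen2016CriticalPadicL] = arXiv:1508.03982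
Thm. 1.2.1; [BenoisBuyukboduk2022] = arXiv:2008.12536 Thm. 7.3(iii); [GreenbergVatsal2000] Thm. 1.3.
-/

set_option autoImplicit false
-- the Theorems namespace of a single-conjunct summit repeats the summit name by design (D-0017)
set_option linter.dupNamespace false

noncomputable section

open scoped Classical MatrixGroups

namespace Summit.BirchSwinnertonDyer.BirchSwinnertonDyer.Theorems.SlopeDichotomyA2BetaExit

open WeierstrassCurve CongruenceSubgroup Literature.NumberTheory.EllipticCurves
  Literature.NumberTheory.EllipticCurves.ModularForms
  Literature.NumberTheory.EllipticCurves.OMSWeightTwo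
  Summit.BirchSwinnertonDyer.Rank1Residual

/-- **The β-RIDER of the pair `(W, p)`: the critical-slope `p`-adic `L`-function has a SIMPLE zero
at the trivial character.**  There are a weight-two newform `f` of `W` (`IsNewformOf W f`, any
level), a root `β ∈ ℚ_p` of `X² − a_p X + p` of critical slope `v_p(β) = 1` (`a_p = W.LFunction p`,
the `p`-th Dirichlet coefficient), and an overconvergent Hecke eigen-lift `Φ` of the `p`-stabilised
symbol `φ_β` (`IsEigenLift W f β Φ`, Pollack–Stevens Def. 6.4 — unique when it exists, by
Bellaïche's Thm. 1 / `IsEigenLift.unique`) whose `L`-function `L_p(Φ, β; T) = ∑ c_k T^k`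
(`criticalSlopePAdicLFunction`, PS §9.1) has `PowerSeries.order = 1`, i.e. `c₀ = 0 ≠ c₁`.
The `∃`-form makes the predicate FALSE (not vacuous) where no eigen-lift exists (θ-critical pairs).
It is the β-analogue of the α-rider "`ord_T L_p(f,α,T) = 1`" (⟺ Schneider in rank one).
[cite: PollackStevens2011, Def. 6.4 (p. 31) and §9.1 (p. 41)] [cite: BuyukbodukPollackSasaki2018, Cor. 1.1.2] -/
def HasBetaOrderOne (W : WeierstrassCurve ℚ) (p : ℕ) [Fact p.Prime] : Prop :=
  ∃ (N : ℕ) (_ : NeZero N) (f : CuspForm (Gamma0 N) 2) (β : ℚ_[p]) (Φ : OMSymb p (N * p)),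
    IsNewformOf W f ∧ β ^ 2 - (W.LFunction p : ℚ_[p]) * β + p = 0 ∧ Padic.valuation β = 1 ∧
      IsEigenLift W f β Φ ∧ (criticalSlopePAdicLFunction Φ β).order = 1

/-- **Crux S_β2 `BetaOrderOneOnDegenerateA2` — on the α-degenerate locus of corner A2 the
critical-slope `L`-function has a simple zero.**  For every globally minimal elliptic `W/ℚ` and
prime `p` with `X1.TypeBRankOne W p` (`p > 2` good ordinary anomalous, `E[p]` reducible of
Greenberg–Vatsal parity type B, `ord_{s=1} L(E,s) = 1`) and a CANONICAL cyclotomic `p`-adic height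
datum violating Schneider's conjecture (`h_α(P,P) = 0`): `HasBetaOrderOne W p`.  Intended proof:
`L_p(f_β, 0) = (1 − 1/β)² L(E,1)/Ω⁺ = 0` (PS Prop. 6.5; tree
`constantCoeff_criticalSlopePAdicLFunction_of_isEigenLift`); the slope gap
`h_α(P,P) − h_β(P,P) = c·log_ω(P)²`, `c ≠ 0`, forces `h_β(P,P) ≠ 0` (Perrin-Riou 1993 §3.3.7
Rem. (ii)); the β-`p`-adic Gross–Zagier formula `L′_{p,β}(f,1) = (1 − 1/β)² c(f) h_β(P_f,P_f)`
(Büyükboduk–Pollack–Sasaki Cor. 1.1.2, stated WITHOUT irreducibility hypothesis; preprint) with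
`c(f) ≠ 0` (Gross–Zagier) gives `[T¹] ≠ 0`; the eigen-lift exists off CM (degenerate ⇒ non-CM by
Bertrand; non-CM ⇒ `f_β` not θ-critical, Emerton) by Pollack–Stevens 2013.  Why it might fail: BPS
Cor. 1.1.2 rests on Kobayashi's unpublished higher-weight non-ordinary Gross–Zagier; "non-CM ⇒ not
θ-critical" in weight two is an unpublished note (Greenberg's question otherwise).  CLOSED; OPEN;
nothing asserted. [cite: BuyukbodukPollackSasaki2018, Thm. 1.1.1 and Cor. 1.1.2] [cite: PerrinRiou1993AIF, §3.3.7 Rem. (ii)]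
[cite: PollackStevens2011, Prop. 6.5 (p. 31)] -/
@[conjecture]
def BetaOrderOneOnDegenerateA2 : Prop :=
  ∀ (W : WeierstrassCurve ℚ) [W.IsElliptic] [W.IsGloballyMinimal] (p : ℕ) [Fact p.Prime],
    X1.TypeBRankOne W p →
      (∃ Dh : PAdicHeightData W p, Dh.IsCanonical ∧ ¬ SchneiderConjecture Dh) → HasBetaOrderOne W p

/-- **Crux S_β3 `BSDpOfBetaOrderOneA2` — the β-twin of the kernel's corner-A2 theorem: on corner A2
the β-rider gives the `p`-part of BSD.**  For every globally minimal elliptic `W/ℚ` and prime `p`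
with `X1.TypeBRankOne W p` and `HasBetaOrderOne W p` (the critical-slope `L_p(f_β,T)` has a simple
zero at `T = 0`): Miller's `BSDp W p`.  Compare `X1.bsdp_of_typeBRankOne_of_schneider` (α-rider
`h_α ≠ 0` ⟺ `ord_T L_p(f,α,T) = 1`).  Intended proof: Perrin-Riou 1993 Prop. 3.4.6 in direction
`N = D_β` — her hypotheses there are `CP(V)` (⟸ the ORDINARY main conjecture for the good lattice,
Greenberg–Vatsal 2000 Thm. 1.3, via her Prop. 3.4.4 and Kato 2004 Thms. 12.4/12.5), `Réc(V)`
(Colmez 1998), `Ш` finite (GZK) and a pairing on `kerLoc_p` which is VACUOUS in rank one — giving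
`BSD_{D_β}(V)` up to a `p`-adic unit, non-void iff `h_β(P,P) ≠ 0` (her Rem. (ii)); the
identification of her β-coordinate `𝔏_PR^{(β)}` with `L_p(f_β,T)` (BPS Thm. 6.1.2(β) = Hansen 2016
Thm. 1.2.1, preprint; Benois–Büyükboduk 2022 Thm. 7.3(iii) published up to `E^×`, `p ≥ 5`); BPS Cor.
1.1.2 to convert `L′_{p,β}` into `L′(E,1)/Ω·Reg_∞`; Gross–Zagier 1986 and the Manin constant
(Mazur 1978) as in BPS §6.2 — with the torsion terms equal to `1` on type B instead of "omitted by
irreducibility".  NO β-main conjecture enters.  Why it might fail: the UNIT in Hansen's comparison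
at `p = 3` / reducible `E[p]`; the integrality of the Mazur–Swinnerton-Dyer measure w.r.t. the Néron
lattice at a reducible prime (Wuthrich 2014) in Perrin-Riou's bookkeeping.  CLOSED; OPEN; nothing
asserted. [cite: PerrinRiou1993AIF, Prop. 3.4.4 and Prop. 3.4.6 with Rem. (i)–(ii)]
[cite: BuyukbodukPollackSasaki2018, Thm. 6.1.2 and §6.2] [cite: Hansen2016CriticalPadicL, Thm. 1.2.1]
[cite: GreenbergVatsal2000, Thm. 1.3] -/
@[conjecture]
def BSDpOfBetaOrderOneA2 : Prop :=
  ∀ (W : WeierstrassCurve ℚ) [W.IsElliptic] [W.IsGloballyMinimal] (p : ℕ) [Fact p.Prime],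
    X1.TypeBRankOne W p → HasBetaOrderOne W p → BSDp W p

end Summit.BirchSwinnertonDyer.BirchSwinnertonDyer.Theorems.SlopeDichotomyA2BetaExit

end
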